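import Summits.BirchSwinnertonDyer.Rank1Residual.Additive.FormalGroupBallPointsAddII
import Summits.BirchSwinnertonDyer.Rank1Residual.Additive.KobayashiHondaIso
import Literature.NumberTheory.EllipticCurves.FormalGroupLogHomAbelProofs
import Literature.NumberTheory.EllipticCurves.FormalGroupFiniteHeightProofs
import Literature.RingTheory.FormalGroups.HondaTypeTransport
import HarnessLib

/-!
# The Honda isomorphism is a homomorphism of formal groups, and its evaluation on `E₁(K)` — for the crux
# `SignedTransportAtTwo` (stmt-BirchSwinnertonDyer-20333, route `ThetaPartnerAtTwo`, line `bridge` v16, stub `stub_sel2Tb`,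
# steps T1/T2) (lead prover bsd-wall-tp2-p1 g5; `--supports stmt-BirchSwinnertonDyer-20333`; route-independent, closes nothing)

HONEST FRAMING. THEOREMS ONLY (no definition); nothing about any Selmer group is asserted; BSD is not proved by any of this.
No import of any route file.

WHY. p544432 (`exists_padicInt_formalLog_subst_eq_formalLog`) gives, for two curves with the same `a_p`, an INTEGRAL
series `ψ ∈ Xℤ_p⟦X⟧` with `log_A ∘ ψ = log_W`. This file turns `ψ` into a map of points:

* §1 (power series, any prime `p`, any two Weierstrass equations `M_W, M_A / ℤ_p` with elliptic generic fibres):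
  `coeff_one_eq_one_of_formalLog_subst` (`ψ = X + ⋯`), `subst_formalGroupLaw_eq` — **`ψ` is a homomorphism of formal
  groups: `ψ(F_W(X, Y)) = F_A(ψ X, ψ Y)` in `ℤ_p⟦X, Y⟧`** (apply `log_A`: both sides have logarithm `log_W X + log_W Y`
  by `formalLog_subst_formalGroupLaw`, and `log_A` has a substitution inverse), and the substitution inverse
  `ψ⁻¹ ∈ Xℤ_p⟦X⟧` (`norm_coeff_substInvOfIsUnit_le_one`).
* §2 (points over a complete ultrametric normed `ℚ_p`-algebra `K` which is a field): with the tree's evaluation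
  dictionary (`BallEval.ptOf`, `zCoord_add_eq_evF`, `ev_subst`): `ψ(F_W(u, v)) = F_A(ψ u, ψ v)` at points
  (`coe_ev₁_evF`), `ψ⁻¹(ψ t) = t` (`coe_ev₁_substInv_ev₁`), and **`P ↦ P_A(ψ(z(P)))` is additive on `E₁(K)` and
  injective** (`ptOf_ev₁_zCoord_add`, `eq_zero_of_ev₁_zCoord_eq_zero`).

This is Kobayashi 2003 §8 / B. D. Kim 2009 Prop. 2.11–2.12 "`Ê ≅ Ê'` over `ℤ_p` since both have Honda type `X² + p`",
at the level of points of `E₁`, for every `p` (used at `p = 2`).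

References: [Honda1970] Thm. 2; [Kobayashi2003] Thm. 8.4, §8.4; [BDKim2009] Prop. 2.11–2.12 (p. 186);
[SilvermanAEC2009] IV.2, IV.5.2, VII.2.2.
-/

set_option autoImplicit false
-- D-0017: single-problem summit, so `Summit.BirchSwinnertonDyer.BirchSwinnertonDyer.…` repeats a namespace BY DESIGN.
set_option linter.dupNamespace false

noncomputable section

open scoped Classical

open PowerSeries WeierstrassCurve Literature.RingTheory.FormalGroups Literature.NumberTheory.EllipticCurves
  Literature.NumberTheory.EllipticCurves.FormalGroupChart
  Summit.BirchSwinnertonDyer.Rank1Residual.Additive Summit.BirchSwinnertonDyer.Rank1Residual.Additive.BallEval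
  Literature.NumberTheory.GaloisRepresentations.LubinTate

namespace Summit.BirchSwinnertonDyer.BirchSwinnertonDyer.Theorems.SignedTransportAtTwo

variable {p : ℕ} [hp : Fact p.Prime]

/-! ## §1 `ψ` is a homomorphism of formal groups -/

section Series

variable (MW MA : WeierstrassCurve ℤ_[p]) {ψ : ℚ_[p]⟦X⟧} (hψ0 : constantCoeff ψ = 0) (hψ : ∀ n, ‖coeff n ψ‖ ≤ 1)
  (hlog : (MA.map (PadicInt.Coe.ringHom (p := p))).formalLog.subst ψ = (MW.map (PadicInt.Coe.ringHom (p := p))).formalLog)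

include hψ0 hlog in
/-- `ψ = X + ⋯`: a strong isomorphism (compare linear coefficients in `log_A ∘ ψ = log_W`, both logarithms being
`X + ⋯`). [cite: Honda1970, Thm. 2] -/
theorem coeff_one_eq_one_of_formalLog_subst : coeff 1 ψ = 1 := by
  have h := congrArg (coeff 1) hlog
  rw [coeff_one_subst_eq_mul _ hψ0, coeff_one_formalLog, coeff_one_formalLog, one_mul] at h
  exact h

include hψ0 hψ hlog in
/-- `liftInt ψ = X + ⋯` over `ℤ_p`: constant coefficient `0` and linear coefficient `1`. [folklore] -/
theorem constantCoeff_liftInt_eq_zero_and_coeff_one :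
    constantCoeff (liftInt ψ hψ) = 0 ∧ coeff 1 (liftInt ψ hψ) = 1 := by
  refine ⟨?_, ?_⟩
  · rw [← coeff_zero_eq_constantCoeff_apply, liftInt, coeff_mk]
    apply Subtype.ext
    change coeff 0 ψ = 0
    rw [coeff_zero_eq_constantCoeff_apply, hψ0]
  · rw [liftInt, coeff_mk]
    apply Subtype.ext
    exact coeff_one_eq_one_of_formalLog_subst MW MA hψ0 hlog

/-- `MvPowerSeries.map ℤ_p → ℚ_p` is injective. [folklore] -/
theorem mvPowerSeries_map_injective {σ : Type*} :
    Function.Injective (MvPowerSeries.map (σ := σ) (PadicInt.Coe.ringHom (p := p))) := by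
  intro f g h
  ext n
  have := congrArg (MvPowerSeries.coeff n) h
  rw [MvPowerSeries.coeff_map, MvPowerSeries.coeff_map] at this
  exact Subtype.val_injective this

/-- Composition of a one-variable substitution followed by a several-variable one:
`b ∘ (f ∘ a) = f ∘ (b ∘ a)`. [folklore] -/
theorem mvSubst_subst {R : Type*} [CommRing R] {τ υ : Type*} {a : MvPowerSeries τ R} (ha : HasSubst a)
    {b : τ → MvPowerSeries υ R} (hb : MvPowerSeries.HasSubst b) (f : R⟦X⟧) :
    MvPowerSeries.subst b (f.subst a) = f.subst (MvPowerSeries.subst b a) := by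
  change MvPowerSeries.subst b (MvPowerSeries.subst (fun _ : Unit ↦ a) f) =
    MvPowerSeries.subst (fun _ : Unit ↦ MvPowerSeries.subst b a) f
  rw [MvPowerSeries.subst_comp_subst_apply (HasSubst.const ha) hb]

/-- **Homomorphism identity over `ℚ_p`**: if `log_A ∘ ψ = log_W` then `ψ(F_W(X, Y)) = F_A(ψ X, ψ Y)` in `ℚ_p⟦X, Y⟧`
(both sides have `log_A`-image `log_W X + log_W Y`; cancel `log_A = X + ⋯`). [cite: SilvermanAEC2009, IV.5.2] -/
theorem subst_formalGroupLaw_eq_rat {VW VA : WeierstrassCurve ℚ_[p]} {θ : ℚ_[p]⟦X⟧} (hθ0 : constantCoeff θ = 0)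
    (hθ : VA.formalLog.subst θ = VW.formalLog) :
    θ.subst VW.formalGroupLaw =
      MvPowerSeries.subst (fun i : Fin 2 ↦ θ.subst (MvPowerSeries.X i : MvPowerSeries (Fin 2) ℚ_[p])) VA.formalGroupLaw := by
  set lA := VA.formalLog with hlA
  set lW := VW.formalLog with hlW
  set b : Fin 2 → MvPowerSeries (Fin 2) ℚ_[p] := fun i ↦ θ.subst (MvPowerSeries.X i : MvPowerSeries (Fin 2) ℚ_[p])
    with hb
  have hθs : HasSubst θ := HasSubst.of_constantCoeff_zero' hθ0
  have hlA0 : constantCoeff lA = 0 := constantCoeff_formalLog _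
  have hlAs : HasSubst lA := HasSubst.of_constantCoeff_zero' hlA0
  have hFW : HasSubst VW.formalGroupLaw := HasSubst.of_constantCoeff_zero VW.constantCoeff_formalGroupLaw
  have hFA : HasSubst VA.formalGroupLaw := HasSubst.of_constantCoeff_zero VA.constantCoeff_formalGroupLaw
  have hb0 : ∀ i, MvPowerSeries.constantCoeff (b i) = 0 := fun i ↦
    constantCoeff_subst_eq_zero (MvPowerSeries.constantCoeff_X i) θ hθ0
  have hbs : MvPowerSeries.HasSubst b := MvPowerSeries.hasSubst_of_constantCoeff_zero hb0
  -- the two candidates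
  set L := θ.subst VW.formalGroupLaw with hL
  set Rr := MvPowerSeries.subst b VA.formalGroupLaw with hRr
  have hL0 : MvPowerSeries.constantCoeff L = 0 := constantCoeff_subst_eq_zero VW.constantCoeff_formalGroupLaw θ hθ0
  have hR0 : MvPowerSeries.constantCoeff Rr = 0 :=
    MvPowerSeries.constantCoeff_subst_eq_zero hbs hb0 VA.constantCoeff_formalGroupLaw
  have hLs : HasSubst L := HasSubst.of_constantCoeff_zero hL0
  have hRs : HasSubst Rr := HasSubst.of_constantCoeff_zero hR0
  -- `log_A ∘ L = log_W X + log_W Y`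
  have h1 : lA.subst L = lW.subst (MvPowerSeries.X 0 : MvPowerSeries (Fin 2) ℚ_[p]) +
      lW.subst (MvPowerSeries.X 1 : MvPowerSeries (Fin 2) ℚ_[p]) := by
    rw [hL, ← subst_comp_subst_apply hθs hFW, hlA, hθ, hlW]
    exact VW.formalLog_subst_formalGroupLaw
  -- `log_A ∘ R = log_W X + log_W Y`
  have h2 : lA.subst Rr = lW.subst (MvPowerSeries.X 0 : MvPowerSeries (Fin 2) ℚ_[p]) +
      lW.subst (MvPowerSeries.X 1 : MvPowerSeries (Fin 2) ℚ_[p]) := by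
    have hbi : ∀ i : Fin 2, MvPowerSeries.subst b (lA.subst (MvPowerSeries.X i : MvPowerSeries (Fin 2) ℚ_[p])) =
        lW.subst (MvPowerSeries.X i : MvPowerSeries (Fin 2) ℚ_[p]) := fun i ↦ by
      rw [mvSubst_subst (HasSubst.X i) hbs, MvPowerSeries.subst_X hbs, hb]
      change subst (subst (MvPowerSeries.X i) θ) lA = _
      rw [← subst_comp_subst_apply hθs (HasSubst.X i), hlA, hθ]
    rw [hRr, ← mvSubst_subst hFA hbs, hlA, VA.formalLog_subst_formalGroupLaw, MvPowerSeries.subst_add hbs,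
      ← hlA, hbi 0, hbi 1]
  -- cancel `log_A`
  have hunit : IsUnit (coeff 1 lA) := by rw [hlA, coeff_one_formalLog]; exact isUnit_one
  set eA := lA.substInvOfIsUnit hunit with heA
  have hcancel : ∀ {G : MvPowerSeries (Fin 2) ℚ_[p]}, HasSubst G → subst (lA.subst G) eA = G := by
    intro G hG
    rw [← subst_comp_subst_apply hlAs hG, heA, subst_substInvOfIsUnit_left lA hlA0 hunit, subst_X hG]
  rw [← hcancel hLs, ← hcancel hRs, h1, h2]

include hψ0 hlog in
/-- **`ψ` is a homomorphism of formal groups over `ℤ_p`: `ψ(F_W(X, Y)) = F_A(ψ X, ψ Y)` in `ℤ_p⟦X, Y⟧`** (the `ℚ_p`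
identity `subst_formalGroupLaw_eq_rat`, descended along the injection `ℤ_p⟦X,Y⟧ → ℚ_p⟦X,Y⟧`; `F` commutes with base
change, `map_formalGroupLaw`). [cite: SilvermanAEC2009, IV.5.2] [cite: Honda1970, Thm. 2] -/
theorem subst_formalGroupLaw_eq :
    (liftInt ψ hψ).subst MW.formalGroupLaw =
      MvPowerSeries.subst (fun i : Fin 2 ↦ (liftInt ψ hψ).subst (MvPowerSeries.X i : MvPowerSeries (Fin 2) ℤ_[p]))
        MA.formalGroupLaw := by
  set φ := PadicInt.Coe.ringHom (p := p) with hφ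
  have hψℤ0 : constantCoeff (liftInt ψ hψ) = 0 := (constantCoeff_liftInt_eq_zero_and_coeff_one MW MA hψ0 hψ hlog).1
  have hFW : HasSubst MW.formalGroupLaw := HasSubst.of_constantCoeff_zero MW.constantCoeff_formalGroupLaw
  have hb0 : ∀ i : Fin 2, MvPowerSeries.constantCoeff ((liftInt ψ hψ).subst (MvPowerSeries.X i : MvPowerSeries (Fin 2) ℤ_[p])) = 0 :=
    fun i ↦ constantCoeff_subst_eq_zero (MvPowerSeries.constantCoeff_X i) _ hψℤ0
  have hbs : MvPowerSeries.HasSubst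
      (fun i : Fin 2 ↦ (liftInt ψ hψ).subst (MvPowerSeries.X i : MvPowerSeries (Fin 2) ℤ_[p])) :=
    MvPowerSeries.hasSubst_of_constantCoeff_zero hb0
  apply mvPowerSeries_map_injective (p := p)
  rw [map_subst hFW, map_liftInt, map_formalGroupLaw, MvPowerSeries.map_subst hbs, map_formalGroupLaw]
  have hb : (fun i : Fin 2 ↦ MvPowerSeries.map φ ((liftInt ψ hψ).subst (MvPowerSeries.X i : MvPowerSeries (Fin 2) ℤ_[p]))) =
      fun i : Fin 2 ↦ ψ.subst (MvPowerSeries.X i : MvPowerSeries (Fin 2) ℚ_[p]) := by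
    funext i
    rw [map_subst (HasSubst.X i), map_liftInt, MvPowerSeries.map_X]
  rw [hb]
  exact subst_formalGroupLaw_eq_rat hψ0 hlog

include hψ0 hψ hlog in
/-- **The substitution inverse of `ψ` lies in `Xℤ_p⟦X⟧`** (`ψ = X + ⋯` is integral; tree
`norm_coeff_substInvOfIsUnit_le_one`): there is `ψ' ∈ Xℤ_p⟦X⟧` with `ψ' ∘ ψ = X = ψ ∘ ψ'`. [cite: Honda1970, Thm. 2] -/
theorem exists_substInv_liftInt :
    ∃ ψ' : ℤ_[p]⟦X⟧, constantCoeff ψ' = 0 ∧ ψ'.subst (liftInt ψ hψ) = PowerSeries.X ∧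
      (liftInt ψ hψ).subst ψ' = PowerSeries.X := by
  have h1 : coeff 1 ψ = 1 := coeff_one_eq_one_of_formalLog_subst MW MA hψ0 hlog
  have hu : IsUnit (coeff 1 ψ) := by rw [h1]; exact isUnit_one
  set θ := ψ.substInvOfIsUnit hu with hθ
  have hθint : ∀ n, ‖coeff n θ‖ ≤ 1 := norm_coeff_substInvOfIsUnit_le_one hψ0 h1 hψ hu
  have hθ0 : constantCoeff θ = 0 := constantCoeff_substInvOfIsUnit ψ hu
  have hψs : HasSubst ψ := HasSubst.of_constantCoeff_zero' hψ0
  have hθs : HasSubst θ := HasSubst.of_constantCoeff_zero' hθ0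
  have hψℤ0 : constantCoeff (liftInt ψ hψ) = 0 := (constantCoeff_liftInt_eq_zero_and_coeff_one MW MA hψ0 hψ hlog).1
  have hθℤ0 : constantCoeff (liftInt θ hθint) = 0 := by
    rw [← coeff_zero_eq_constantCoeff_apply, liftInt, coeff_mk]
    apply Subtype.ext
    change coeff 0 θ = 0
    rw [coeff_zero_eq_constantCoeff_apply, hθ0]
  refine ⟨liftInt θ hθint, hθℤ0, ?_, ?_⟩
  · apply HondaFss.map_injective (p := p)
    rw [map_subst_apply (HasSubst.of_constantCoeff_zero' hψℤ0), map_liftInt, map_liftInt, map_X, hθ]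
    exact subst_substInvOfIsUnit_left ψ hψ0 hu
  · apply HondaFss.map_injective (p := p)
    rw [map_subst_apply (HasSubst.of_constantCoeff_zero' hθℤ0), map_liftInt, map_liftInt, map_X, hθ]
    exact subst_substInvOfIsUnit_right ψ hψ0 hu

end Series

/-! ## §2 Evaluation on `E₁(K)` for a complete ultrametric normed `ℚ_p`-algebra `K` -/

section Points

variable {K : Type*} [NontriviallyNormedField K] [NormedAlgebra ℚ_[p] K] [IsUltrametricDist K] [CompleteSpace K]
  (MW MA : WeierstrassCurve ℤ_[p]) {ψ : ℚ_[p]⟦X⟧} (hψ : ∀ n, ‖coeff n ψ‖ ≤ 1)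
  (hψℤ0 : constantCoeff (liftInt ψ hψ) = 0)

/-- `ev₁` depends only on the point (proof-irrelevance helper). [folklore] -/
theorem ev₁_congr {t t' : unitBall K} (h : t = t') (ht : PowerSeries.HasEval t)
    (ht' : PowerSeries.HasEval t') (f : ℤ_[p]⟦X⟧) : ev₁ p K t ht f = ev₁ p K t' ht' f := by
  subst h; rfl

include hψℤ0 in
/-- `‖ψ(t)‖ ≤ ‖t‖ < 1` on the open unit disc (`ψ(0) = 0`, integral coefficients). [cite: SilvermanAEC2009, IV.1] -/
theorem norm_ev₁_liftInt_lt_one {t : unitBall K} (ht : ‖(t : K)‖ < 1) :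
    ‖((ev₁ p K t (hasEval_of_norm_lt_one ht) (liftInt ψ hψ) : unitBall K) : K)‖ < 1 :=
  (norm_ev₁_le _ ht.le hψℤ0).trans_lt ht

include hψℤ0 in
/-- **`ψ(F_W(u, v)) = F_A(ψ(u), ψ(v))` at points of the open unit disc** (`subst_formalGroupLaw_eq` evaluated with the
tree's dictionary `ev_subst` / `ev_subst_formalGroupLaw` / `ev_subst_X₀,₁`). [cite: SilvermanAEC2009, IV.2 and VII.2.2] -/
theorem coe_ev₁_evF (hhom : (liftInt ψ hψ).subst MW.formalGroupLaw =
      MvPowerSeries.subst (fun i : Fin 2 ↦ (liftInt ψ hψ).subst (MvPowerSeries.X i : MvPowerSeries (Fin 2) ℤ_[p]))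
        MA.formalGroupLaw)
    {u v : unitBall K} (hu : ‖(u : K)‖ < 1) (hv : ‖(v : K)‖ < 1) :
    ((ev₁ p K (evF p MW u v hu hv) (hasEval_of_norm_lt_one (norm_evF_lt_one hu hv)) (liftInt ψ hψ) : unitBall K) : K) =
      (evF p MA (ev₁ p K u (hasEval_of_norm_lt_one hu) (liftInt ψ hψ)) (ev₁ p K v (hasEval_of_norm_lt_one hv) (liftInt ψ hψ))
        (norm_ev₁_liftInt_lt_one hψ hψℤ0 hu) (norm_ev₁_liftInt_lt_one hψ hψℤ0 hv) : K) := by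
  have hb0 : ∀ i : Fin 2, MvPowerSeries.constantCoeff ((liftInt ψ hψ).subst (MvPowerSeries.X i : MvPowerSeries (Fin 2) ℤ_[p])) = 0 :=
    fun i ↦ constantCoeff_subst_eq_zero (MvPowerSeries.constantCoeff_X i) _ hψℤ0
  have hbs : MvPowerSeries.HasSubst
      (fun i : Fin 2 ↦ (liftInt ψ hψ).subst (MvPowerSeries.X i : MvPowerSeries (Fin 2) ℤ_[p])) :=
    MvPowerSeries.hasSubst_of_constantCoeff_zero hb0
  have h := congrArg (fun f ↦ ((ev p K ![u, v] (hasEval_pair hu hv) f : unitBall K) : K)) hhom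
  rw [ev_subst_formalGroupLaw hu hv] at h
  rw [h, ev_subst hbs, evF, ev_apply]
  congr 2
  funext i
  fin_cases i
  · exact ev_subst_X₀ hu hv _
  · exact ev_subst_X₁ hu hv _

include hψℤ0 in
/-- **`ψ⁻¹(ψ(t)) = t` at points**, for a series `ψ'` with `ψ' ∘ ψ = X` over `ℤ_p` (the tree's `ev₁_subst`).
[cite: SilvermanAEC2009, IV.2] -/
theorem coe_ev₁_ev₁_of_subst_eq_X {ψ' : ℤ_[p]⟦X⟧} (hinv : ψ'.subst (liftInt ψ hψ) = PowerSeries.X)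
    {t : unitBall K} (ht : ‖(t : K)‖ < 1) :
    ev₁ p K (ev₁ p K t (hasEval_of_norm_lt_one ht) (liftInt ψ hψ))
        (hasEval_of_norm_lt_one (norm_ev₁_liftInt_lt_one hψ hψℤ0 ht)) ψ' = t := by
  rw [← ev₁_subst hψℤ0 (hasEval_of_norm_lt_one ht), hinv, ev₁_X]

variable [hEA : (MA.map PadicInt.Coe.ringHom).IsElliptic] [hEW : (MW.map PadicInt.Coe.ringHom).IsElliptic]
  [hintW : (curveK p K MW).IsIntegral (NormedField.valuation (K := K)).integer]
  [hintA : (curveK p K MA).IsIntegral (NormedField.valuation (K := K)).integer]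

omit hintA in
include hψℤ0 in
/-- **The Honda map on `E₁(K)` is additive: `P_A(ψ(z(P + Q))) = P_A(ψ(z P)) + P_A(ψ(z Q))`** for `P, Q ∈ E₁(K)`
(`z(P + Q) = F_W(zP, zQ)` and `ψ(F_W(u,v)) = F_A(ψ u, ψ v) = z(P_A(ψ u) + P_A(ψ v))`).
[cite: Kobayashi2003, §8.4] [cite: BDKim2009, Prop. 2.11–2.12 (p. 186)] [cite: SilvermanAEC2009, VII.2.2] -/
theorem ptOf_ev₁_add (hhom : (liftInt ψ hψ).subst MW.formalGroupLaw =
      MvPowerSeries.subst (fun i : Fin 2 ↦ (liftInt ψ hψ).subst (MvPowerSeries.X i : MvPowerSeries (Fin 2) ℤ_[p]))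
        MA.formalGroupLaw)
    {P Q : (curveK p K MW).toAffine.Point}
    (hP : P ∈ kernel (NormedField.valuation (K := K)) (curveK p K MW))
    (hQ : Q ∈ kernel (NormedField.valuation (K := K)) (curveK p K MW))
    (hPQ : P + Q ∈ kernel (NormedField.valuation (K := K)) (curveK p K MW)) :
    ptOf p K MA (ev₁ p K (zBall (P + Q) hPQ) (hasEval_of_norm_lt_one (norm_zBall_lt_one hPQ)) (liftInt ψ hψ))
        (norm_ev₁_liftInt_lt_one hψ hψℤ0 (norm_zBall_lt_one hPQ)) =
      ptOf p K MA (ev₁ p K (zBall P hP) (hasEval_of_norm_lt_one (norm_zBall_lt_one hP)) (liftInt ψ hψ))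
          (norm_ev₁_liftInt_lt_one hψ hψℤ0 (norm_zBall_lt_one hP)) +
        ptOf p K MA (ev₁ p K (zBall Q hQ) (hasEval_of_norm_lt_one (norm_zBall_lt_one hQ)) (liftInt ψ hψ))
          (norm_ev₁_liftInt_lt_one hψ hψℤ0 (norm_zBall_lt_one hQ)) := by
  rw [ptOf_add]
  refine ptOf_congr ?_ _ _
  have hz : zBall (P + Q) hPQ = evF p MW (zBall P hP) (zBall Q hQ) (norm_zBall_lt_one hP) (norm_zBall_lt_one hQ) :=
    Subtype.ext (zCoord_add_eq_evF hP hQ)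
  have h1 : ev₁ p K (zBall (P + Q) hPQ) (hasEval_of_norm_lt_one (norm_zBall_lt_one hPQ)) (liftInt ψ hψ) =
      ev₁ p K (evF p MW (zBall P hP) (zBall Q hQ) (norm_zBall_lt_one hP) (norm_zBall_lt_one hQ))
        (hasEval_of_norm_lt_one (norm_evF_lt_one (norm_zBall_lt_one hP) (norm_zBall_lt_one hQ))) (liftInt ψ hψ) :=
    ev₁_congr hz _ _ _
  rw [h1]
  exact coe_ev₁_evF MW MA hψ hψℤ0 hhom _ _

omit hEW hintA in
include hψℤ0 in
/-- **The Honda map on `E₁(K)` is injective**: if `P_A(ψ(z P)) = O` then `P = O` (`z(P_A(t)) = t`, and `ψ` has a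
substitution inverse `ψ'` over `ℤ_p` with `ψ'(0) = 0`). [cite: Kobayashi2003, §8.4] [cite: SilvermanAEC2009, VII.2.2] -/
theorem eq_zero_of_ptOf_ev₁_eq_zero {ψ' : ℤ_[p]⟦X⟧} (hψ'0 : constantCoeff ψ' = 0)
    (hinv : ψ'.subst (liftInt ψ hψ) = PowerSeries.X)
    {P : (curveK p K MW).toAffine.Point} (hP : P ∈ kernel (NormedField.valuation (K := K)) (curveK p K MW))
    (h0 : ptOf p K MA (ev₁ p K (zBall P hP) (hasEval_of_norm_lt_one (norm_zBall_lt_one hP)) (liftInt ψ hψ))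
        (norm_ev₁_liftInt_lt_one hψ hψℤ0 (norm_zBall_lt_one hP)) = 0) : P = 0 := by
  have hz : ((ev₁ p K (zBall P hP) (hasEval_of_norm_lt_one (norm_zBall_lt_one hP)) (liftInt ψ hψ) : unitBall K) : K) = 0 := by
    have := congrArg Affine.Point.zCoord h0
    rwa [zCoord_ptOf, Affine.Point.zCoord_zero] at this
  have hz' : ev₁ p K (zBall P hP) (hasEval_of_norm_lt_one (norm_zBall_lt_one hP)) (liftInt ψ hψ) = 0 := Subtype.ext hz
  have h := coe_ev₁_ev₁_of_subst_eq_X hψ hψℤ0 hinv (norm_zBall_lt_one hP)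
  have h00 : ‖((0 : unitBall K) : K)‖ < 1 := by simp
  have h' : ev₁ p K (0 : unitBall K) (hasEval_of_norm_lt_one h00) ψ' = zBall P hP := by
    rw [← h]; exact (ev₁_congr hz' _ _ _).symm
  -- `ψ'(0) = 0`
  have hnorm : ‖((ev₁ p K (0 : unitBall K) (hasEval_of_norm_lt_one h00) ψ' : unitBall K) : K)‖ ≤ ‖((0 : unitBall K) : K)‖ :=
    norm_ev₁_le _ h00.le hψ'0
  have h0' : ((ev₁ p K (0 : unitBall K) (hasEval_of_norm_lt_one h00) ψ' : unitBall K) : K) = 0 := by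
    have : ‖((0 : unitBall K) : K)‖ = 0 := by simp
    rw [this] at hnorm
    exact norm_le_zero_iff.mp hnorm
  have ht : P.zCoord = 0 := by
    have := congrArg (fun s : unitBall K ↦ (s : K)) h'
    simp only [h0'] at this
    rw [← coe_zBall hP]
    exact this.symm
  exact (zCoord_eq_zero_iff hP).mp ht

end Points

end Summit.BirchSwinnertonDyer.BirchSwinnertonDyer.Theorems.SignedTransportAtTwo

end
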